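import Summits.BirchSwinnertonDyer.BirchSwinnertonDyer.Theorems.KimAtThreeDeepLowerSmallDefect
import Summits.BirchSwinnertonDyer.BirchSwinnertonDyer.Theorems.KimAtThreeShallowEqDeepPeriod
import HarnessLib

/-!
# Route `KimAtThreeKolyvagin` (rung W2), crux `ShallowEqDeepOffKatoStratum` (item 19599, §S child of
# `ShallowEqDeepAtTorsionFree` 19077): the row SOCKETS — upper twin ∧ «Tamagawa divisibility of ALL
# Kurihara numbers» ⟹ shallow = deep; the obstruction is necessary given the lower twin

Cell `bsd-addord`, seat `bsd-addord-w2-c4` (gen 5), item `stmt-BirchSwinnertonDyer-19599` (stub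
`stub_nonAdditive`; the companion file `KimAtThreeShallowEqDeepOffStratumNonAdditiveRows` specialises these
sockets to the by-name rows at `p = 3`). Notation on one row: `a = ∂⁽⁰⁾(δ̃)` (`kuriharaPartial … 0`),
`s = ord_p #Ш(E/ℚ)(p)`, `c = v_p(∏ c_ℓ)`, `d = ∂^{(∞)}_{deep}(δ̃)` (`kuriharaPartialDeepInfty`),
`∂ = ∂^{(∞)}(δ̃)` (`kuriharaPartialInfty`, all levels). The crux at a row is `d ≤ ∂`; its UPPER twin (crux
`DeepUpperAtThreeOffKatoStratum` 19562 at the row) is `s + d ≤ a`; its LOWER twin (crux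
`DeepLowerAtThreeOffKatoStratum` 19679 at the row) is `a ≤ s + d`.

* §1 (`ℕ∞` bookkeeping, general `p`): upper twin ∧ `a ≤ s + ∂` ⟹ `d ≤ ∂`; lower twin ∧ `d ≤ ∂` ⟹
  `a ≤ s + ∂`; so given BOTH twins (Kim's formula `s = a − d` in its deep reading) the crux ⟺ `a ≤ s + ∂`
  (= g0's threshold-free certificate lane (C) of `KimAtThreeShallowEqDeepCertificateBound`, here in closed
  form). Tamagawa currency: upper twin ∧ `a ≤ s + c` ∧ `c ≤ ∂` ⟹ crux — with `c = v_p(∏ c_ℓ)` the last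
  hypothesis is «TamDiv∞»: `p^{v_p(∏ c_ℓ)}` DIVIDES EVERY cyclic-level Kurihara number (Kim 2022 Conj. 1.10,
  `≥` half, ALL levels; OPEN — Castella–Sano arXiv:2601.14504 announce Conj. 1.10 ⟺ Kato's main conjecture in
  determinant form); OUTRIGHT on the slice `a ≤ s` (`c = 0`). Conversely lower twin ∧ `s + c ≤ a` ∧ crux
  ⟹ `c ≤ ∂`: TamDiv∞ is NECESSARY. Also: upper twin ∧ `a ≤ s + c` ⟹ `d ≤ c` («deep defect ≤ Tamagawa»).
  Certificate socket: a family of cyclic levels of ONE `ν`, one in every `𝒩_k`, realising the all-levels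
  minimum (e.g. deep UNIT Kurihara numbers when `∂ = 0`) gives the crux with no twin and no `BSD_p`.
* §2 (`BSD_p` currency, odd `p`, `E[p]` irreducible, `f` the newform, analytic rank `0`, period transfer,
  GZK): Miller's UPPER half `MissingUpperBoundAt` ⟹ `s + v_p(∏ c_ℓ) ≤ a` (the converse companion of w2-c2's
  `kuriharaPartial_zero_le_sha_add_tamagawa_of_missingLowerBoundAt`); hence upper twin ∧ `MissingLowerBoundAt`
  ∧ TamDiv∞ ⟹ crux (outright when `p ∤ ∏ c_ℓ`), lower twin ∧ `MissingUpperBoundAt` ∧ crux ⟹ TamDiv∞, and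
  GIVEN `MissingPPartAt W p` (= `BSD(E,p)` in Miller's currency) and both twins: crux ⟺ TamDiv∞. Reading
  for the planner: on a `BSD(E,p)`-known row the off-stratum triple {lower 19679, upper 19562, shallow =
  deep 19599} ⟺ {upper twin (deep certificates: `d ≤ v_p(∏ c_ℓ)`), TamDiv∞}.

HONEST FRAMING. Theorems only (pure `ℕ∞` / valuation bookkeeping); the sibling cruxes enter only as
their ROW conclusions, displayed; Miller's halves are hypotheses; nothing asserted, nothing booked; crux
19599 stays OPEN. At `p = 3` NO admissible published input gives the crux on a non-additive row beyond
these sockets: Kim AJM 148 Thm. 1.9 is `p ≥ 5` verbatim; Kim 2025 (arXiv:2505.09121) Thm. 1.2 is announced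
(`Literature/…/Kim2025/*OPEN`, inadmissible in this cell).

References: [Kim2022StructureSelmer] §1.5.1, Conj. 1.10, Thm. 1.9 (6); [Kim2025RefinedTNC] Thm. 1.2;
[MazurRubin2004] Def. 4.5.7, Def. 5.2.11, Thm. 5.2.12; [Miller2011LMS] Def. 1.1.
-/

set_option autoImplicit false
-- the Theorems namespace of a single-conjunct summit repeats the summit name by design (D-0017)
set_option linter.dupNamespace false

noncomputable section

open scoped MatrixGroups ModularForm Classical

open CongruenceSubgroup WeierstrassCurve Literature.NumberTheory.EllipticCurves
  Literature.NumberTheory.EllipticCurves.ModularForms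
  Literature.NumberTheory.EllipticCurves.Rank1Residual
  Literature.NumberTheory.EllipticCurves.Rank1Residual.Typed

namespace Summit.BirchSwinnertonDyer.BirchSwinnertonDyer.Theorems.KimAtThreeShallowEqDeepOffStratumSockets

open Summit.BirchSwinnertonDyer.Rank1Residual
open Summit.BirchSwinnertonDyer.Rank1Residual.Supersingular
open Summit.BirchSwinnertonDyer.BirchSwinnertonDyer.Theorems.KimAtThreeKolyvaginUnitLevelOneRungs
open Summit.BirchSwinnertonDyer.BirchSwinnertonDyer.Theorems.KimAtThreeDeepUpperDefectObstruction
open Summit.BirchSwinnertonDyer.BirchSwinnertonDyer.Theorems.KimAtThreeDeepLowerSmallDefect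
open Summit.BirchSwinnertonDyer.BirchSwinnertonDyer.Theorems.KimAtThreeShallowEqDeepPeriod


/-! ### §1 `ℕ∞` bookkeeping at one row (general `p`) -/

section Row

variable (W : WeierstrassCurve ℚ) [W.IsGloballyMinimal] (p : ℕ) {N : ℕ} (f : CuspForm (Gamma0 N) 2)

/-- **Upper twin ∧ `a ≤ s + ∂` ⟹ shallow = deep at the row**: `s + d ≤ a ≤ s + ∂` gives `d ≤ ∂`
(`s` finite). The hypothesis `a ≤ s + ∂` says that EVERY cyclic-level Kurihara number is divisible by
`p^{a − s}` (= g0's threshold-free certificate lane (C)). [cite: Kim2022StructureSelmer, §1.5.1 (PDF p. 7)]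
[cite: MazurRubin2004, Def. 5.2.11] -/
theorem shallowEqDeep_conclusion_of_upperRow_of_le_add_partialInfty {s : ℕ}
    (hU : ∃ d : ℕ, kuriharaPartialDeepInfty W p f = d ∧
      ((s + d : ℕ) : ℕ∞) ≤ kuriharaPartial W p f 0)
    (hdiv : kuriharaPartial W p f 0 ≤ (s : ℕ∞) + kuriharaPartialInfty W p f) :
    kuriharaPartialDeepInfty W p f ≤ kuriharaPartialInfty W p f := by
  obtain ⟨d, hd, hle⟩ := hU
  have h := hle.trans hdiv
  rw [hd]
  rcases eq_or_ne (kuriharaPartialInfty W p f) ⊤ with htop | hne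
  · rw [htop]
    exact le_top
  · lift kuriharaPartialInfty W p f to ℕ using hne with j hj
    have h' : s + d ≤ s + j := by exact_mod_cast h
    exact_mod_cast (show d ≤ j by omega)

/-- **Lower twin ∧ shallow = deep ⟹ `a ≤ s + ∂`** (`a ≤ s + d ≤ s + ∂`). [cite: Kim2022StructureSelmer, §1.5.1 (PDF p. 7)]
[cite: MazurRubin2004, Def. 5.2.11] -/
theorem le_add_partialInfty_of_lowerRow_of_shallowEqDeep_conclusion {s : ℕ}
    (hL : ∃ d : ℕ, kuriharaPartialDeepInfty W p f = d ∧
      kuriharaPartial W p f 0 ≤ ((s + d : ℕ) : ℕ∞))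
    (hS : kuriharaPartialDeepInfty W p f ≤ kuriharaPartialInfty W p f) :
    kuriharaPartial W p f 0 ≤ (s : ℕ∞) + kuriharaPartialInfty W p f := by
  obtain ⟨d, hd, hle⟩ := hL
  refine hle.trans ?_
  rw [Nat.cast_add, ← hd]
  exact add_le_add le_rfl hS

/-- **Given BOTH twins at the row (Kim's formula `s = a − d` in its deep reading), shallow = deep ⟺
`a ≤ s + ∂`.** [cite: Kim2022StructureSelmer, Thm. 1.9 (6), §1.5.1] [cite: MazurRubin2004, Thm. 5.2.12] -/
theorem shallowEqDeep_conclusion_iff_le_add_partialInfty_of_rows {s : ℕ}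
    (hL : ∃ d : ℕ, kuriharaPartialDeepInfty W p f = d ∧
      kuriharaPartial W p f 0 ≤ ((s + d : ℕ) : ℕ∞))
    (hU : ∃ d : ℕ, kuriharaPartialDeepInfty W p f = d ∧
      ((s + d : ℕ) : ℕ∞) ≤ kuriharaPartial W p f 0) :
    kuriharaPartialDeepInfty W p f ≤ kuriharaPartialInfty W p f ↔
      kuriharaPartial W p f 0 ≤ (s : ℕ∞) + kuriharaPartialInfty W p f :=
  ⟨le_add_partialInfty_of_lowerRow_of_shallowEqDeep_conclusion W p f hL,
    shallowEqDeep_conclusion_of_upperRow_of_le_add_partialInfty W p f hU⟩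

/-- **Tamagawa currency: upper twin ∧ `a ≤ s + c` ∧ `c ≤ ∂` ⟹ shallow = deep at the row.** With
`c = v_p(∏ c_ℓ)` the middle hypothesis is the lower half of `BSD_p` in `∂`-currency (§2) and the last
is «TamDiv∞»: every cyclic-level Kurihara number is divisible by `p^{v_p(∏ c_ℓ)}` (Kim 2022 Conj. 1.10,
`≥` half, ALL levels). [cite: Kim2022StructureSelmer, Conj. 1.10 (PDF p. 8), §1.5.1 (PDF p. 7)] -/
theorem shallowEqDeep_conclusion_of_upperRow_of_le_add_of_le_partialInfty {s c : ℕ}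
    (hU : ∃ d : ℕ, kuriharaPartialDeepInfty W p f = d ∧
      ((s + d : ℕ) : ℕ∞) ≤ kuriharaPartial W p f 0)
    (hlow : kuriharaPartial W p f 0 ≤ ((s + c : ℕ) : ℕ∞))
    (htam : (c : ℕ∞) ≤ kuriharaPartialInfty W p f) :
    kuriharaPartialDeepInfty W p f ≤ kuriharaPartialInfty W p f := by
  refine shallowEqDeep_conclusion_of_upperRow_of_le_add_partialInfty W p f hU (hlow.trans ?_)
  rw [Nat.cast_add]
  exact add_le_add le_rfl htam

/-- **… OUTRIGHT on the slice `a ≤ s`** (`c = 0`: e.g. `p ∤ ∏ c_ℓ` under the lower half of `BSD_p`).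
[cite: Kim2022StructureSelmer, Thm. 1.9 (6), §1.5.1 (PDF p. 7)] -/
theorem shallowEqDeep_conclusion_of_upperRow_of_le_sha {s : ℕ}
    (hU : ∃ d : ℕ, kuriharaPartialDeepInfty W p f = d ∧
      ((s + d : ℕ) : ℕ∞) ≤ kuriharaPartial W p f 0)
    (hlow : kuriharaPartial W p f 0 ≤ (s : ℕ∞)) :
    kuriharaPartialDeepInfty W p f ≤ kuriharaPartialInfty W p f :=
  shallowEqDeep_conclusion_of_upperRow_of_le_add_of_le_partialInfty W p f (c := 0) hU
    (by simpa using hlow) zero_le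

/-- **Upper twin ∧ `a ≤ s + c` ⟹ the deep limit is at most `c`** (`s + d ≤ a ≤ s + c`): with
`c = v_p(∏ c_ℓ)`, «deep defect ≤ Tamagawa». [cite: Kim2022StructureSelmer, Conj. 1.10 (PDF p. 8)] -/
theorem deepInfty_le_of_upperRow_of_le_add {s c : ℕ}
    (hU : ∃ d : ℕ, kuriharaPartialDeepInfty W p f = d ∧
      ((s + d : ℕ) : ℕ∞) ≤ kuriharaPartial W p f 0)
    (hlow : kuriharaPartial W p f 0 ≤ ((s + c : ℕ) : ℕ∞)) :
    kuriharaPartialDeepInfty W p f ≤ (c : ℕ∞) := by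
  obtain ⟨d, hd, hle⟩ := hU
  have h' : s + d ≤ s + c := by exact_mod_cast hle.trans hlow
  rw [hd]
  exact_mod_cast (show d ≤ c by omega)

/-- **Necessity: lower twin ∧ `s + c ≤ a` ∧ shallow = deep ⟹ `c ≤ ∂`** (`s + c ≤ a ≤ s + d ≤ s + ∂`):
with `c = v_p(∏ c_ℓ)` (upper half of `BSD_p`), TamDiv∞ is NECESSARY for the crux given the lower twin.
[cite: Kim2022StructureSelmer, Conj. 1.10 (PDF p. 8), §1.5.1 (PDF p. 7)] -/
theorem le_partialInfty_of_lowerRow_of_add_le_of_shallowEqDeep_conclusion {s c : ℕ}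
    (hL : ∃ d : ℕ, kuriharaPartialDeepInfty W p f = d ∧
      kuriharaPartial W p f 0 ≤ ((s + d : ℕ) : ℕ∞))
    (hup : ((s + c : ℕ) : ℕ∞) ≤ kuriharaPartial W p f 0)
    (hS : kuriharaPartialDeepInfty W p f ≤ kuriharaPartialInfty W p f) :
    (c : ℕ∞) ≤ kuriharaPartialInfty W p f := by
  have h := hup.trans (le_add_partialInfty_of_lowerRow_of_shallowEqDeep_conclusion W p f hL hS)
  rcases eq_or_ne (kuriharaPartialInfty W p f) ⊤ with htop | hne
  · rw [htop]
    exact le_top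
  · lift kuriharaPartialInfty W p f to ℕ using hne with j hj
    have h' : s + c ≤ s + j := by exact_mod_cast h
    exact_mod_cast (show c ≤ j by omega)

/-- **Certificate socket: a family of cyclic levels of ONE `ν = i`, one in every `𝒩_k`, each with
divisibility index `≤ e`, bounds the deep limit by `e`** (the level-`k` invariant is `≤ min(k, ord δ̃_n) ≤ e`
for every `k`). [cite: MazurRubin2004, Def. 4.5.7, Def. 5.2.11] [cite: Kim2022StructureSelmer, Def. 2.13 (PDF p. 14)] -/
theorem deepInfty_le_of_forall_depth_exists_level {i : ℕ} {e : ℕ∞}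
    (h : ∀ k : ℕ, ∃ n : ℕ, IsCyclicKolyvaginLevel W p n ∧ Kato.IsKolyvaginProduct W p k n ∧
      n.primeFactors.card = i ∧ kuriharaDivIndex W p f n ≤ e) :
    kuriharaPartialDeepInfty W p f ≤ e := by
  refine (kuriharaPartialDeepInfty_le W p f i).trans ?_
  unfold kuriharaPartialDeep
  refine iSup_le fun k => ?_
  obtain ⟨n, hn, hk, hi, he⟩ := h k
  exact (kuriharaPartialDeepAt_le W p f hn hk hi).trans ((min_le_right _ _).trans he)

/-- **… so a family realising the ALL-LEVELS minimum `∂` at arbitrarily deep cyclic levels of one `ν`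
gives shallow = deep at the row** — no twin, no `BSD_p` (this is the `⟸` half of g2's
`not_kuriharaPartialDeepInfty_le_kuriharaPartialInfty_iff_exists_dip`; with `e = 0` it is the family of
deep UNIT Kurihara numbers Kim's formula predicts on the rows `p ∤ ∏ c_ℓ`). [cite: Kim2025RefinedTNC, Thm. 1.2]
[cite: MazurRubin2004, Thm. 5.2.12] -/
theorem shallowEqDeep_conclusion_of_forall_depth_exists_level {i : ℕ}
    (h : ∀ k : ℕ, ∃ n : ℕ, IsCyclicKolyvaginLevel W p n ∧ Kato.IsKolyvaginProduct W p k n ∧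
      n.primeFactors.card = i ∧ kuriharaDivIndex W p f n ≤ kuriharaPartialInfty W p f) :
    kuriharaPartialDeepInfty W p f ≤ kuriharaPartialInfty W p f :=
  deepInfty_le_of_forall_depth_exists_level W p f h

end Row

/-! ### §2 `BSD_p` currency (general odd `p`): Miller's halves -/

section BSDCurrency

variable (W : WeierstrassCurve ℚ) [W.IsElliptic] [W.IsGloballyMinimal] (p : ℕ) [Fact p.Prime]
  {N : ℕ} [NeZero N] (f : CuspForm (Gamma0 N) 2)

/-- **Miller's UPPER half ⇒ the `∂`-currency upper bound `s + v_p(∏ c_ℓ) ≤ ∂⁽⁰⁾(δ̃)`** (converse companion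
of w2-c2's `kuriharaPartial_zero_le_sha_add_tamagawa_of_missingLowerBoundAt`, same row: odd `p`, `E[p]`
irreducible, `f` the newform of `W`, analytic rank `0`, `p`-adic period transfer, GZK):
`#Ш_an = (L(E,1)/Ω(W))·#E(ℚ)²_tors/∏ c_ℓ` with `p ∤ #E(ℚ)_tors`, so `ord_p #Ш ≤ ord_p #Ш_an` reads
`s + v_p(∏ c_ℓ) ≤ ord_p(L(E,1)/Ω(W)) = ∂⁽⁰⁾`. [cite: Miller2011LMS, Def. 1.1] [cite: Kim2022StructureSelmer, §1.4.3 and §1.5.1 (PDF p. 7)] -/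
theorem sha_add_tamagawa_le_kuriharaPartial_zero_of_missingUpperBoundAt
    (hGZK : rank_eq_analyticRank_of_analyticRank_le_one) (hp2 : p ≠ 2)
    (hirr : W.HasIrreducibleModPGaloisRep p) (hf : IsNewformOf W f)
    (hord : kuriharaVanishingOrder W p f = 0)
    (hper : ∃ u : ℚ, ‖(u : ℚ_[p])‖ = 1 ∧ W.realPeriodRat = u * plusPeriod f)
    (hup : MissingUpperBoundAt W p) :
    ((padicValNat p (Nat.card (AddCommGroup.primaryComponent W.sha p)) +
        padicValNat p W.tamagawaProduct : ℕ) : ℕ∞) ≤ kuriharaPartial W p f 0 := by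
  have h0 : ratPlusSymbol f 0 ≠ 0 :=
    ratPlusSymbol_zero_ne_zero_of_kuriharaVanishingOrder_eq_zero W p f hord
  have hL : W.entireLFunction 1 ≠ 0 := hf.entireLFunction_one_ne_zero_of_ratPlusSymbol_zero_ne_zero h0
  have hr0 : W.analyticRank = 0 := analyticRank_eq_zero_of_entireLFunction_one_ne_zero hL
  obtain ⟨-, hfin⟩ := hGZK W (by rw [hr0]; exact zero_le_one)
  haveI : Finite W.sha := hfin
  -- the rational witness `t = L(E,1)/Ω(W)`
  have hfin0 : kuriharaPartial W p f 0 < ⊤ := by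
    rw [kuriharaPartial_zero]
    exact kuriharaDivIndex_one_lt_top_of_kuriharaVanishingOrder_eq_zero W p f hord
  obtain ⟨a, ha⟩ : ∃ a : ℕ, kuriharaPartial W p f 0 = a :=
    (ENat.ne_top_iff_exists.mp hfin0.ne).imp fun a h => h.symm
  obtain ⟨t, ht, -⟩ :=
    exists_padicValRat_le_of_kuriharaPartial_zero_le W p f hp2 hirr hf hord hper (m := a) ha.le
  have hΩC : (W.realPeriodRat : ℂ) ≠ 0 := Complex.ofReal_ne_zero.mpr W.realPeriodRat_pos_holds.ne'
  have ht0 : t ≠ 0 := by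
    rintro rfl
    apply hL
    have h' := ht
    rw [div_eq_iff hΩC] at h'
    rw [h']
    simp
  obtain ⟨q, hq, hv⟩ := hup
  have hqt : q = t * (W.torsionOrder : ℚ) ^ 2 / (W.tamagawaProduct : ℚ) := by
    have h1 := hq.symm.trans (shaAn_eq_of_analyticRank_eq_zero W hGZK hr0 ht)
    exact_mod_cast h1
  have hsha : padicValNat p (Nat.card (AddCommGroup.primaryComponent W.sha p)) =
      padicValNat p W.shaOrder := by
    unfold WeierstrassCurve.shaOrder
    exact padicValNat_card_addPrimaryComponent p
  rw [hqt, padicValRat_shaAn_witness W p hirr ht0, ← hsha] at hv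
  have hv' : ((padicValNat p (Nat.card (AddCommGroup.primaryComponent W.sha p)) +
      padicValNat p W.tamagawaProduct : ℕ) : ℤ) ≤ padicValRat p t := by
    rw [Nat.cast_add]
    linarith
  exact natCast_le_kuriharaPartial_zero_of_le_padicValRat_of_irreducible W p f hp2 hirr hf ht hv'

/-- **Upper twin ∧ lower half of `BSD_p` ∧ TamDiv∞ ⟹ shallow = deep at the row** (odd `p`, `E[p]`
irreducible, newform `f`, analytic rank `0`, period transfer, GZK). [cite: Miller2011LMS, Def. 1.1]
[cite: Kim2022StructureSelmer, Conj. 1.10 (PDF p. 8), Thm. 1.9 (6)] -/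
theorem shallowEqDeep_conclusion_of_upperRow_of_missingLowerBoundAt_of_tamagawa_le_partialInfty
    (hGZK : rank_eq_analyticRank_of_analyticRank_le_one) (hp2 : p ≠ 2)
    (hirr : W.HasIrreducibleModPGaloisRep p) (hf : IsNewformOf W f)
    (hord : kuriharaVanishingOrder W p f = 0)
    (hper : ∃ u : ℚ, ‖(u : ℚ_[p])‖ = 1 ∧ W.realPeriodRat = u * plusPeriod f)
    (hlow : MissingLowerBoundAt W p)
    (hU : ∃ d : ℕ, kuriharaPartialDeepInfty W p f = d ∧
      ((padicValNat p (Nat.card (AddCommGroup.primaryComponent W.sha p)) + d : ℕ) : ℕ∞) ≤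
        kuriharaPartial W p f 0)
    (htam : ((padicValNat p W.tamagawaProduct : ℕ) : ℕ∞) ≤ kuriharaPartialInfty W p f) :
    kuriharaPartialDeepInfty W p f ≤ kuriharaPartialInfty W p f :=
  shallowEqDeep_conclusion_of_upperRow_of_le_add_of_le_partialInfty W p f hU
    (kuriharaPartial_zero_le_sha_add_tamagawa_of_missingLowerBoundAt W p f hGZK hp2 hirr hf hord hper
      hlow) htam

/-- **… OUTRIGHT when `p ∤ ∏ c_ℓ`.** [cite: Miller2011LMS, Def. 1.1] [cite: Kim2022StructureSelmer, Thm. 1.9 (6)] -/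
theorem shallowEqDeep_conclusion_of_upperRow_of_missingLowerBoundAt_of_not_dvd_tamagawa
    (hGZK : rank_eq_analyticRank_of_analyticRank_le_one) (hp2 : p ≠ 2)
    (hirr : W.HasIrreducibleModPGaloisRep p) (hf : IsNewformOf W f)
    (hord : kuriharaVanishingOrder W p f = 0)
    (hper : ∃ u : ℚ, ‖(u : ℚ_[p])‖ = 1 ∧ W.realPeriodRat = u * plusPeriod f)
    (hlow : MissingLowerBoundAt W p)
    (hU : ∃ d : ℕ, kuriharaPartialDeepInfty W p f = d ∧
      ((padicValNat p (Nat.card (AddCommGroup.primaryComponent W.sha p)) + d : ℕ) : ℕ∞) ≤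
        kuriharaPartial W p f 0)
    (htam : ¬ p ∣ W.tamagawaProduct) :
    kuriharaPartialDeepInfty W p f ≤ kuriharaPartialInfty W p f := by
  refine shallowEqDeep_conclusion_of_upperRow_of_missingLowerBoundAt_of_tamagawa_le_partialInfty W p f
    hGZK hp2 hirr hf hord hper hlow hU ?_
  rw [padicValNat.eq_zero_of_not_dvd htam, Nat.cast_zero]
  exact zero_le

/-- **Necessity: lower twin ∧ upper half of `BSD_p` ∧ shallow = deep ⟹ TamDiv∞** (`v_p(∏ c_ℓ) ≤ ∂^{(∞)}`).
[cite: Miller2011LMS, Def. 1.1] [cite: Kim2022StructureSelmer, Conj. 1.10 (PDF p. 8)] -/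
theorem tamagawa_le_partialInfty_of_lowerRow_of_missingUpperBoundAt_of_shallowEqDeep_conclusion
    (hGZK : rank_eq_analyticRank_of_analyticRank_le_one) (hp2 : p ≠ 2)
    (hirr : W.HasIrreducibleModPGaloisRep p) (hf : IsNewformOf W f)
    (hord : kuriharaVanishingOrder W p f = 0)
    (hper : ∃ u : ℚ, ‖(u : ℚ_[p])‖ = 1 ∧ W.realPeriodRat = u * plusPeriod f)
    (hup : MissingUpperBoundAt W p)
    (hL : ∃ d : ℕ, kuriharaPartialDeepInfty W p f = d ∧
      kuriharaPartial W p f 0 ≤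
        ((padicValNat p (Nat.card (AddCommGroup.primaryComponent W.sha p)) + d : ℕ) : ℕ∞))
    (hS : kuriharaPartialDeepInfty W p f ≤ kuriharaPartialInfty W p f) :
    ((padicValNat p W.tamagawaProduct : ℕ) : ℕ∞) ≤ kuriharaPartialInfty W p f :=
  le_partialInfty_of_lowerRow_of_add_le_of_shallowEqDeep_conclusion W p f hL
    (sha_add_tamagawa_le_kuriharaPartial_zero_of_missingUpperBoundAt W p f hGZK hp2 hirr hf hord hper
      hup) hS

/-- **GIVEN `BSD_p` at the row (Miller's `MissingPPartAt`) and both twins (Kim's deep formula),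
shallow = deep at the row ⟺ TamDiv∞.** [cite: Miller2011LMS, Def. 1.1]
[cite: Kim2022StructureSelmer, Conj. 1.10 (PDF p. 8), Thm. 1.9 (6)] [cite: Kim2025RefinedTNC, Thm. 1.2] -/
theorem shallowEqDeep_conclusion_iff_tamagawa_le_partialInfty_of_rows_of_missingPPartAt
    (hGZK : rank_eq_analyticRank_of_analyticRank_le_one) (hp2 : p ≠ 2)
    (hirr : W.HasIrreducibleModPGaloisRep p) (hf : IsNewformOf W f)
    (hord : kuriharaVanishingOrder W p f = 0)
    (hper : ∃ u : ℚ, ‖(u : ℚ_[p])‖ = 1 ∧ W.realPeriodRat = u * plusPeriod f)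
    (hPP : MissingPPartAt W p)
    (hL : ∃ d : ℕ, kuriharaPartialDeepInfty W p f = d ∧
      kuriharaPartial W p f 0 ≤
        ((padicValNat p (Nat.card (AddCommGroup.primaryComponent W.sha p)) + d : ℕ) : ℕ∞))
    (hU : ∃ d : ℕ, kuriharaPartialDeepInfty W p f = d ∧
      ((padicValNat p (Nat.card (AddCommGroup.primaryComponent W.sha p)) + d : ℕ) : ℕ∞) ≤
        kuriharaPartial W p f 0) :
    kuriharaPartialDeepInfty W p f ≤ kuriharaPartialInfty W p f ↔
      ((padicValNat p W.tamagawaProduct : ℕ) : ℕ∞) ≤ kuriharaPartialInfty W p f :=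
  ⟨tamagawa_le_partialInfty_of_lowerRow_of_missingUpperBoundAt_of_shallowEqDeep_conclusion W p f hGZK
      hp2 hirr hf hord hper (lower_and_upper_of_missingPPartAt W p hPP).2 hL,
    shallowEqDeep_conclusion_of_upperRow_of_missingLowerBoundAt_of_tamagawa_le_partialInfty W p f hGZK
      hp2 hirr hf hord hper (lower_and_upper_of_missingPPartAt W p hPP).1 hU⟩

end BSDCurrency

end Summit.BirchSwinnertonDyer.BirchSwinnertonDyer.Theorems.KimAtThreeShallowEqDeepOffStratumSockets

end
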